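import Summits.HodgeConjecture.HodgeConjecture.Theorems.HeckePrymWeilWeilTwelvefoldsSqrtMinus7WeilMultiplicity
import Literature.AlgebraicGeometry.HodgeTheory.WeilClassesDescendingProofs
import Literature.AlgebraicGeometry.HodgeTheory.WeilClasses
import Literature.AlgebraicGeometry.Motives.AbelianVarietyCohomologyExteriorH1
import HarnessLib

/-!
# Crux `HodgeAbelianVarieties` (stmt-HodgeConjecture-1333), line `prym-canonical-z3-split-seeds` — stub `stub_descend`, part I: Weil multiplicities `(n, n)` from a class of the Weil PLANE, every `d`

Registered helper `stub_descend_weilMultiplicity` of the stub `stub_descend` (DESCENDING, Schoen 1998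
§10 / Markman arXiv:2509.23403 §11.5 Step 2), first of three files discharging the PARTNER-SURFACE fact
`Literature.AlgebraicGeometry.HodgeTheory.exists_weilTypeSurface_prod_isHyperbolicWeilType_all` — the one
input of the landed conditional reduction `Stubs.Descend.stub_descend_of_partner_of_schoen` (p95682) that
is not a theorem of the tree (Schoen's transfer is: `Schoen1998_weilClasses_algebraic_of_prod_surface_all_holds`).

**Weil multiplicities from the Weil class, in the Weil-PLANE typing, for every `d ≥ 1`** (B. Moonen,
Yu. Zarhin, J. reine angew. Math. 496 (1998), Criterion (§2); B. van Geemen, LNM 1594 (1994), 4.9 and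
Lemma 5.2 (6) with proof): for a complex abelian `2n`-fold `(A, φ)`, `φ ≫ φ = -(d • 𝟙 A)`, whose Weil
plane `weilClassesOf A φ n d = E₊ ⊔ E₋` (joint eigenclasses of ALL the test pull-backs `(x·𝟙 + y·φ)^*`,
`HodgeTheory/WeilClasses`) contains a NON-ZERO rational class of Hodge type `(n, n)`, both eigenvalues
`± i√d` of `φ^*` on the `(1,0)`-piece of any Hodge model have multiplicity `n`
(`stub_descend_weilMultiplicity`). This is the sibling route's `stub_weilMultiplicity`
(`Theorems/HeckePrymWeilWeilTwelvefoldsSqrtMinus7WeilMultiplicity`, `d = 7`, SINGLE test endomorphism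
`(𝟙 + φ)^*`) re-proved in the typing that expresses Weil type for EVERY `d` — including `d = 3`, the
case `K = ℚ(√-3)` this line consumes, where the single-test typing is false
(`Motives/AimedSplitProduct`, `## Misstatement`). Proof: the Weil line
`E_μ = pullbackEigenclasses A φ (2n) ((x + yμ)²ⁿ)` (`μ = ± i√d`) is spanned by the wedge-basis vector
`b₁ ⌣ ⋯ ⌣ b_{2n}` of an eigenbasis adapted to `V_μ = V_μ^{1,0} ⊕ V_μ^{0,1}` (it is a LINE,
`finrank_pullbackEigenclasses_pow_eq_one`, and contains that vector by multilinearity of `⌣` — no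
separation lemma is needed in this typing), hence has Hodge type `(a, a')`, `a + a' = 2n`
(`pullbackEigenclasses_pow_le_comap_hodgePQ`); a rational `c = c₊ + c₋ ≠ 0` of type `(n, n)` has
`c₋ = conj c₊ ≠ 0` (`eq_conjClass_of_isRationalClass_add`, `ne_zero_of_isRationalClass_add`) of the
two types `(b, b')` and `(a', a)`, whence `a = b = n`. No named fact is taken.
-/

-- every declaration of this problem lives in `Summit.HodgeConjecture.HodgeConjecture.…` (single-problem summit)
set_option linter.dupNamespace false

noncomputable section

open CategoryTheory Complex
open Literature.AlgebraicGeometry Literature.AlgebraicGeometry.Motives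
  Literature.AlgebraicGeometry.HodgeTheory Literature.AlgebraicTopology.SingularHomology
open Summit.HodgeConjecture.HodgeConjecture.Theorems.WeilTwelvefoldsSqrtMinus7.AmnesicSecantSheaves

namespace Summit.HodgeConjecture.HodgeConjecture.Cruxes.HodgeAbelianVarieties.PrymCanonicalZ3SplitSeeds.Stubs.Descend

variable {A : AbelianVariety ℂ}

/-! ### The Weil line `⋀^{2n} V_μ` as joint eigenclasses, and its Hodge type in a fixed model -/

/-- **The Weil line `E_μ = pullbackEigenclasses A φ (2n) ((x + yμ)²ⁿ) = ⋀²ⁿ V_μ` has Hodge type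
`(a, a')`, `a = dim (V_μ ∩ H^{1,0})`, `a' = dim (V_μ ∩ H^{0,1})`, `a + a' = 2n`**, for a complex abelian
`2n`-fold `(A, φ)` with `φ ≫ φ = -(d • 𝟙 A)`, `d ≥ 1`, `μ = ± i√d`, and any Hodge model `M` (van
Geemen, proof of Lemma 5.2 (6): "`⋀²ⁿ W'₊` … has Hodge type `(a, 2n - a)`"; Moonen–Zarhin, Criterion).
Proof on the carriers: `H¹ = H^{1,0} ⊕ H^{0,1}` and `H¹ = V_μ ⊕ V_{-μ}` are `φ^*`-stable, so
`V_μ = (V_μ ∩ H^{1,0}) ⊕ (V_μ ∩ H^{0,1})`, of dimension `2n` (`b₁ = 4n`); for a basis `b` of `H¹`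
adapted to this splitting, `c₁ = b₁ ⌣ ⋯ ⌣ b_{2n}` is a wedge-basis vector of `H²ⁿ = ⋀²ⁿ H¹`
(`abelianVarietyCohomologyExteriorH1_holds`), non-zero, of type `(a, a')` (`cupPowOne_mem_comap_hodgePQ`),
and a joint eigenclass of every `(x·𝟙 + y·φ)^*` with character `(x + yμ)²ⁿ` (multilinearity), i.e.
`c₁ ∈ E_μ`, a LINE (`finrank_pullbackEigenclasses_pow_eq_one`), hence `E_μ = ℂ c₁`.
[cite: vanGeemen1994HodgeAV, 4.9 and proof of Lemma 5.2 (6)] [cite: MoonenZarhin1998WeilClasses, Criterion (§2)] -/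
theorem pullbackEigenclasses_pow_le_comap_hodgePQ {n d : ℕ} (hd : 0 < d) (hA : A.dim = 2 * n)
    {φ : A ⟶ A} (hφ : φ ≫ φ = -(d • 𝟙 A)) {μ : ℂ}
    (hμ : μ = Complex.I * (Real.sqrt d : ℂ) ∨ μ = -(Complex.I * (Real.sqrt d : ℂ)))
    (M : HodgeModel (2 * n) A.X) :
    Module.finrank ℂ ↥(Module.End.eigenspace (complexBetti.map φ.hom.hom.hom 1).hom μ ⊓
        (M.hodgePQ 1 1 0).comap (M.pullback 1).hom) +
      Module.finrank ℂ ↥(Module.End.eigenspace (complexBetti.map φ.hom.hom.hom 1).hom μ ⊓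
        (M.hodgePQ 1 0 1).comap (M.pullback 1).hom) = 2 * n ∧
    (pullbackEigenclasses A φ (2 * n) fun x y ↦ ((x : ℂ) + (y : ℂ) * μ) ^ (2 * n)) ≤
      (M.hodgePQ (2 * n)
        (Module.finrank ℂ ↥(Module.End.eigenspace (complexBetti.map φ.hom.hom.hom 1).hom μ ⊓
          (M.hodgePQ 1 1 0).comap (M.pullback 1).hom))
        (Module.finrank ℂ ↥(Module.End.eigenspace (complexBetti.map φ.hom.hom.hom 1).hom μ ⊓
          (M.hodgePQ 1 0 1).comap (M.pullback 1).hom))).comap (M.pullback (2 * n)).hom := by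
  classical
  haveI := finite_complexBetti_abelianVariety A 1
  have hX : IsSmoothProjective (2 * n) A.X := hA ▸ AbelianVariety.isSmoothProjective_holds
  have hΛ := abelianVarietyCohomologyExteriorH1_holds.hasExteriorCohomologyH1 A
  have hb₁ : Module.finrank ℂ (complexBetti A.X 1) = 2 * (2 * n) := by
    rw [AbelianVariety.finrank_complexBetti_one, hA]
  set T := (complexBetti.map φ.hom.hom.hom 1).hom with hT
  set H10 := (M.hodgePQ 1 1 0).comap (M.pullback 1).hom with hH10
  set H01 := (M.hodgePQ 1 0 1).comap (M.pullback 1).hom with hH01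
  set a := Module.finrank ℂ ↥(Module.End.eigenspace T μ ⊓ H10) with ha
  set a' := Module.finrank ℂ ↥(Module.End.eigenspace T μ ⊓ H01) with ha'
  -- `H¹ = H^{1,0} ⊕ H^{0,1}`
  have h1 : IsCompl H10 H01 := by
    have hind := iSupIndep_comap_hodgePQ M 1
    have htop := iSup_comap_hodgePQ_eq_top M 1
    let i₁ : ↥(Finset.HasAntidiagonal.antidiagonal 1) :=
      ⟨(1, 0), Finset.HasAntidiagonal.mem_antidiagonal.2 rfl⟩
    let i₀ : ↥(Finset.HasAntidiagonal.antidiagonal 1) :=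
      ⟨(0, 1), Finset.HasAntidiagonal.mem_antidiagonal.2 rfl⟩
    have hne : i₁ ≠ i₀ := fun h ↦
      one_ne_zero (congrArg (fun i : ↥(Finset.HasAntidiagonal.antidiagonal 1) ↦ i.1.1) h)
    have hdisj : Disjoint H10 H01 := by
      have hd' := hind.pairwiseDisjoint hne
      rw [Function.onFun, Submodule.disjoint_def] at hd'
      exact Submodule.disjoint_def.2 fun x hx hx' ↦ hd' x hx hx'
    refine ⟨hdisj, codisjoint_iff.2 (top_le_iff.1 ?_)⟩
    rw [← htop]
    refine iSup_le fun pq ↦ ?_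
    obtain ⟨⟨x, y⟩, hxy⟩ := pq
    have hxy' : x + y = 1 := Finset.HasAntidiagonal.mem_antidiagonal.1 hxy
    rcases Nat.eq_zero_or_pos x with rfl | hx
    · obtain rfl : y = 1 := by omega
      exact le_sup_right
    · obtain rfl : x = 1 := by omega
      obtain rfl : y = 0 := by omega
      exact le_sup_left
  -- `φ^*`-stability of the pieces
  have hstab : ∀ p q : ℕ, ∀ v ∈ (M.hodgePQ 1 p q).comap (M.pullback 1).hom,
      T v ∈ (M.hodgePQ 1 p q).comap (M.pullback 1).hom :=
    fun p q v hv ↦ M.pullback_map_mem_hodgePQ_of_endomorphism hX φ.hom.hom.hom hv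
  -- `H¹ = V_μ ⊕ V_{-μ}`, `dim V_μ = 2n`
  have hcompl : IsCompl (Module.End.eigenspace T μ) (Module.End.eigenspace T (-μ)) := by
    rcases hμ with rfl | rfl
    · exact isCompl_eigenspace_eigenspace_neg hd hφ
    · rw [neg_neg]; exact (isCompl_eigenspace_eigenspace_neg hd hφ).symm
  have hp : Module.finrank ℂ ↥(Module.End.eigenspace T μ) = 2 * n := by
    have hps : Module.finrank ℂ ↥(Module.End.eigenspace T (Complex.I * (Real.sqrt d : ℂ))) = 2 * n := by
      have h := two_mul_finrank_eigenspace_eq hd hφ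
      rw [hb₁] at h
      change 2 * Module.finrank ℂ ↥(Module.End.eigenspace T (Complex.I * (Real.sqrt d : ℂ))) =
        2 * (2 * n) at h
      omega
    rcases hμ with rfl | rfl
    · exact hps
    · have h := finrank_eigenspace_eq_finrank_eigenspace_neg hd hφ
      change Module.finrank ℂ ↥(Module.End.eigenspace T (Complex.I * (Real.sqrt d : ℂ))) =
        Module.finrank ℂ ↥(Module.End.eigenspace T (-(Complex.I * (Real.sqrt d : ℂ)))) at h
      rw [← h, hps]
  -- `V_μ = (V_μ ∩ H^{1,0}) ⊕ (V_μ ∩ H^{0,1})`, `a + a' = 2n`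
  have hsplit := eigenspace_eq_inf_sup_inf T h1 (hstab 1 0) (hstab 0 1) μ
  have hsum : a + a' = 2 * n := by
    rw [← hp]; exact (finrank_eigenspace_eq_add T h1 (hstab 1 0) (hstab 0 1) μ).symm
  refine ⟨hsum, ?_⟩
  -- an adapted basis and the class `c₁ = b₁ ⌣ ⋯ ⌣ b_{2n}`
  obtain ⟨r, b, p, q, hbE, hbPQ, hp1, hq1⟩ := exists_basis_adapted hcompl hsplit h1.disjoint hsum
  set w : Fin (2 * n) → complexBetti A.X 1 := fun i ↦ b (Fin.castAdd r i) with hw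
  set c₁ := cupPowOne ℂ (ComplexPoints A.X) (2 * n) w with hc₁
  -- Hodge type `(a, a')`
  have htype : c₁ ∈ (M.hodgePQ (2 * n) a a').comap (M.pullback (2 * n)).hom := by
    have h := cupPowOne_mem_comap_hodgePQ (2 * n) A.X M hX (2 * n) w p q fun i ↦ by
      rcases hbPQ i with ⟨hp, hq, hmem⟩ | ⟨hp, hq, hmem⟩
      · rw [hp, hq]; exact hmem
      · rw [hp, hq]; exact hmem
    rwa [hp1, hq1] at h
  -- `c₁ ≠ 0`: a wedge-basis vector of `H²ⁿ = ⋀²ⁿ H¹`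
  have h0 : c₁ ≠ 0 := by
    let Bw : Module.Basis (Set.powersetCard (Fin (2 * n + r)) (2 * n)) ℂ (complexBetti A.X (2 * n)) :=
      (b.exteriorPower (2 * n)).map (hΛ.equiv (2 * n))
    let S₀ : Set.powersetCard (Fin (2 * n + r)) (2 * n) :=
      Set.powersetCard.ofFinEmbEquiv (Fin.castAddOrderEmb r)
    have hS : Bw S₀ = c₁ := by
      change hΛ.equiv (2 * n) ((b.exteriorPower (2 * n)) S₀) = _
      rw [exteriorPower.basis_apply, HasExteriorCohomologyH1.equiv_apply, exteriorPower.ιMulti_family,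
        wedgeToCup_ιMulti, Equiv.symm_apply_apply]
      congr 1
    rw [← hS]
    exact Bw.ne_zero S₀
  -- `c₁ ∈ E_μ`: a joint eigenclass of every test pull-back `(x·𝟙 + y·φ)^*`
  have hwμ : ∀ i, w i ∈ Module.End.eigenspace T μ := fun i ↦ hbE i
  have hmem : c₁ ∈ pullbackEigenclasses A φ (2 * n) fun x y ↦ ((x : ℂ) + (y : ℂ) * μ) ^ (2 * n) := by
    rw [mem_pullbackEigenclasses_iff]
    intro x y
    change singularCohomology.map ℂ ℂ (AlgPoints.mapContinuous (L := ℂ) (x • 𝟙 A + y • φ).hom.hom.hom)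
      (2 * n) (cupPowOne ℂ _ (2 * n) w) = _
    rw [map_cupPowOne]
    have e : (fun i ↦ singularCohomology.map ℂ ℂ
        (AlgPoints.mapContinuous (L := ℂ) (x • 𝟙 A + y • φ).hom.hom.hom) 1 (w i)) =
        fun i ↦ ((x : ℂ) + (y : ℂ) * μ) • w i := by
      funext i
      exact complexBetti_map_nsmul_id_add_nsmul_one_of_mem_eigenspace (hwμ i) x y
    rw [e, MultilinearMap.map_smul_univ, Finset.prod_const, Finset.card_univ, Fintype.card_fin]
  -- the joint eigenclass space is the line `ℂ c₁`
  have hline : (pullbackEigenclasses A φ (2 * n) fun x y ↦ ((x : ℂ) + (y : ℂ) * μ) ^ (2 * n)) ≤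
      ℂ ∙ c₁ := by
    have hfin : Module.finrank ℂ
        ↥(pullbackEigenclasses A φ (2 * n) fun x y ↦ ((x : ℂ) + (y : ℂ) * μ) ^ (2 * n)) = 1 :=
      finrank_pullbackEigenclasses_pow_eq_one hΛ hb₁ hd hφ hμ
    haveI : FiniteDimensional ℂ
        ↥(pullbackEigenclasses A φ (2 * n) fun x y ↦ ((x : ℂ) + (y : ℂ) * μ) ^ (2 * n)) :=
      Module.finite_of_finrank_eq_succ hfin
    intro c hc
    obtain ⟨t, ht⟩ := (finrank_eq_one_iff_of_nonzero'
      (⟨c₁, hmem⟩ : ↥(pullbackEigenclasses A φ (2 * n) fun x y ↦ ((x : ℂ) + (y : ℂ) * μ) ^ (2 * n)))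
      (by simpa using h0)).1 hfin ⟨c, hc⟩
    refine Submodule.mem_span_singleton.2 ⟨t, ?_⟩
    simpa using congrArg Subtype.val ht
  exact hline.trans ((Submodule.span_singleton_le_iff_mem _ _).2 htype)

/-- `E₊ = weilClassesPlus A φ n d` is the joint eigenclass space of the character `(x + yμ)²ⁿ`,
`μ = i√d` (re-association of the literal character of `HodgeTheory/WeilClasses`). [cite: vanGeemen1994HodgeAV, 4.9] -/
theorem weilClassesPlus_eq_pullbackEigenclasses (φ : A ⟶ A) (n d : ℕ) :
    weilClassesPlus A φ n d =
      pullbackEigenclasses A φ (2 * n)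
        fun x y ↦ ((x : ℂ) + (y : ℂ) * (Complex.I * (Real.sqrt d : ℂ))) ^ (2 * n) := by
  have e : (fun x y : ℕ ↦ ((x : ℂ) + (y : ℂ) * Complex.I * (Real.sqrt d : ℂ)) ^ (2 * n)) =
      fun x y : ℕ ↦ ((x : ℂ) + (y : ℂ) * (Complex.I * (Real.sqrt d : ℂ))) ^ (2 * n) := by
    funext x y; rw [mul_assoc]
  rw [weilClassesPlus, e]

/-- `E₋ = weilClassesMinus A φ n d` is the joint eigenclass space of the character `(x + yμ)²ⁿ`,
`μ = -i√d`. [cite: vanGeemen1994HodgeAV, 4.9] -/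
theorem weilClassesMinus_eq_pullbackEigenclasses (φ : A ⟶ A) (n d : ℕ) :
    weilClassesMinus A φ n d =
      pullbackEigenclasses A φ (2 * n)
        fun x y ↦ ((x : ℂ) + (y : ℂ) * (-(Complex.I * (Real.sqrt d : ℂ)))) ^ (2 * n) := by
  have e : (fun x y : ℕ ↦ ((x : ℂ) - (y : ℂ) * Complex.I * (Real.sqrt d : ℂ)) ^ (2 * n)) =
      fun x y : ℕ ↦ ((x : ℂ) + (y : ℂ) * (-(Complex.I * (Real.sqrt d : ℂ)))) ^ (2 * n) := by
    funext x y; rw [mul_neg, ← sub_eq_add_neg, mul_assoc]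
  rw [weilClassesMinus, e]

/-! ### The registered helper: multiplicities `(n, n)` from a class of the Weil plane -/

/-- **Weil multiplicities from a Weil-PLANE class, every `d ≥ 1`** (registered helper
`stub_descend_weilMultiplicity` of stmt-HodgeConjecture-1333). For a complex abelian `2n`-fold
`(A, φ)`, `φ ≫ φ = -(d • 𝟙 A)`, carrying a NON-ZERO rational class of Hodge type `(n, n)` in its Weil
plane `weilClassesOf A φ n d = E₊ ⊔ E₋ ⊆ H²ⁿ(A(ℂ); ℂ)`, both eigenvalues `± i√d` of `φ^*` on the
`(1,0)`-piece `(M.hodgePQ 1 1 0).comap (M.pullback 1)` of any Hodge model `M` have multiplicity `n`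
(Moonen–Zarhin, Criterion; van Geemen 4.9 and Lemma 5.2 (6): the Weil plane is of type `(n, n)` iff
`(A, K)` is of Weil type). Proof: `E₊`, `E₋` have types `(a, a')`, `(b, b')`, `a + a' = 2n`
(`pullbackEigenclasses_pow_le_comap_hodgePQ`); the rational `c = c₊ + c₋ ≠ 0` has `c₋ = conj c₊`
with both components non-zero (`eq_conjClass_of_isRationalClass_add`,
`ne_zero_of_isRationalClass_add`), so `c₋` has the two types `(b, b')` and `(a', a)`, whence
`(b, b') = (a', a)`; and `c ∈ H^{n,n}` forces `a = n`. For `n = 0`, `H¹ = 0`.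
[cite: MoonenZarhin1998WeilClasses, Criterion (§2)] [cite: vanGeemen1994HodgeAV, 4.9 and Lemma 5.2 (6) with proof] -/
theorem stub_descend_weilMultiplicity :
    ∀ (n d : ℕ) (A : AbelianVariety ℂ) (φ : A ⟶ A), 0 < d → A.dim = 2 * n → φ ≫ φ = -(d • 𝟙 A) →
      (∃ c : complexBetti A.X (2 * n), IsRationalClass c ∧
        IsOfHodgeType (2 * n) A.X (2 * n) n n c ∧ c ∈ weilClassesOf A φ n d ∧ c ≠ 0) →
    ∀ (M : HodgeModel (2 * n) A.X),
      Module.finrank ℂ ↥(Module.End.eigenspace (complexBetti.map φ.hom.hom.hom 1).hom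
            (Complex.I * (Real.sqrt d : ℂ)) ⊓ (M.hodgePQ 1 1 0).comap (M.pullback 1).hom) = n ∧
      Module.finrank ℂ ↥(Module.End.eigenspace (complexBetti.map φ.hom.hom.hom 1).hom
            (-(Complex.I * (Real.sqrt d : ℂ))) ⊓ (M.hodgePQ 1 1 0).comap (M.pullback 1).hom) = n := by
  intro n d A φ hd hA hφ hc M
  haveI := finite_complexBetti_abelianVariety A 1
  rcases Nat.eq_zero_or_pos n with rfl | hn
  · -- `n = 0`: `H¹ = 0`
    have h0 : Module.finrank ℂ (complexBetti A.X 1) = 0 := by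
      rw [AbelianVariety.finrank_complexBetti_one, hA]
    constructor <;> exact Nat.eq_zero_of_le_zero ((Submodule.finrank_le _).trans h0.le)
  have hX : IsSmoothProjective (2 * n) A.X := hA ▸ AbelianVariety.isSmoothProjective_holds
  set s : ℂ := Complex.I * (Real.sqrt d : ℂ) with hs
  set T := (complexBetti.map φ.hom.hom.hom 1).hom with hT
  set H10 := (M.hodgePQ 1 1 0).comap (M.pullback 1).hom with hH10
  set H01 := (M.hodgePQ 1 0 1).comap (M.pullback 1).hom with hH01
  set a := Module.finrank ℂ ↥(Module.End.eigenspace T s ⊓ H10) with ha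
  set a' := Module.finrank ℂ ↥(Module.End.eigenspace T s ⊓ H01) with ha'
  set b := Module.finrank ℂ ↥(Module.End.eigenspace T (-s) ⊓ H10) with hb
  set b' := Module.finrank ℂ ↥(Module.End.eigenspace T (-s) ⊓ H01) with hb'
  -- the two Weil lines and their types
  obtain ⟨hsum, hplus⟩ := pullbackEigenclasses_pow_le_comap_hodgePQ hd hA hφ (μ := s) (Or.inl rfl) M
  obtain ⟨hsum', hminus⟩ := pullbackEigenclasses_pow_le_comap_hodgePQ hd hA hφ (μ := -s) (Or.inr rfl) M
  rw [← weilClassesPlus_eq_pullbackEigenclasses φ n d] at hplus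
  rw [← weilClassesMinus_eq_pullbackEigenclasses φ n d] at hminus
  change a + a' = 2 * n at hsum
  change b + b' = 2 * n at hsum'
  change weilClassesPlus A φ n d ≤ (M.hodgePQ (2 * n) a a').comap (M.pullback (2 * n)).hom at hplus
  change weilClassesMinus A φ n d ≤ (M.hodgePQ (2 * n) b b').comap (M.pullback (2 * n)).hom at hminus
  -- the Weil class `c = c₊ + c₋`, `c₋ = conj c₊`, both non-zero
  obtain ⟨c, hcrat, hctype, hcmem, hc0⟩ := hc
  obtain ⟨cp, hcp, cm, hcm, hcpm⟩ := Submodule.mem_sup.1 hcmem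
  have hcn : c ∈ (M.hodgePQ (2 * n) n n).comap (M.pullback (2 * n)).hom :=
    (isOfHodgeType_iff_mem_hodgePQ hX M c).1 hctype
  have hrat' : IsRationalClass (cp + cm) := by rw [hcpm]; exact hcrat
  have hcm_eq : cm = conjClass (ComplexPoints A.X) (2 * n) cp :=
    eq_conjClass_of_isRationalClass_add hn hd hcp hcm hrat'
  have hcm0 : cm ≠ 0 := (ne_zero_of_isRationalClass_add hn hd hcp hcm hrat' (by rw [hcpm]; exact hc0)).2
  -- `c₋` has the two types `(b, b')` and `(a', a)`
  have hcm₁ : cm ∈ (M.hodgePQ (2 * n) b b').comap (M.pullback (2 * n)).hom := hminus hcm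
  have hcm₂ : cm ∈ (M.hodgePQ (2 * n) a' a).comap (M.pullback (2 * n)).hom := by
    rw [hcm_eq]; exact conjClass_mem_comap_hodgePQ M hX (hplus hcp)
  have hba : (b, b') = (a', a) := hodgeType_unique_of_ne_zero M hcm₁ hcm₂ hcm0
  have hb_eq : b = a' := congrArg Prod.fst hba
  -- `c ∈ H^{n,n}` forces `a = n`
  have han : a = n := by
    by_contra hne
    have hne' : a' ≠ n := by omega
    refine hc0 (eq_zero_of_mem_of_eq_add M hcn (hplus hcp) hcm₂ hcpm.symm ?_ ?_ (by omega))
    · exact fun h ↦ hne (congrArg Prod.fst h)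
    · exact fun h ↦ hne' (congrArg Prod.fst h)
  exact ⟨han, by omega⟩

end Summit.HodgeConjecture.HodgeConjecture.Cruxes.HodgeAbelianVarieties.PrymCanonicalZ3SplitSeeds.Stubs.Descend

end
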